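import Mathlib
import Summits.KontsevichZagierPeriods.KontsevichZagierPeriods.Theorems.SoloInformedVolumeCrux
import HarnessLib

/-!
# SoloInformed — Nash images of the open cube are presentable

First kernel piece of the bookkeeping half of the crux `SoloInformedCubeVolumeResolution`
(paper §8.2, steps R3–R4): the class of an integral representation whose domain is the image of the
OPEN unit cube under an injective `ℚ`-semialgebraic `C¹` map `Φ`, and whose integrand pulls back
(`f ∘ Φ · |det Φ'|`) to the real part of a cube germ, is *presentable* (a member of
`soloInformedPresentable`). Together with LEMMA Q for cube germs (proved here from the grid form
of LEMMA Q for Ayoub generators: `soloInformed_cubeGerm_isSemialgebraicFunOn`) this is exactly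
what turns every closed simplex / cube of a strong Nash triangulation after an embedded resolution
into an Ayoub-presentable term: degenerate Jacobians ON the boundary of the cube are allowed, only
analytic continuation across it is required.

Main results:
* `soloInformed_cubeGerm_isSemialgebraicFunOn`, `soloInformedGermRep` — the cube representation
  `[[0,1]ᵐ, Re G]` of a cube germ exists (LEMMA Q on grid cells, glued) and is presentable;
* `soloInformed_volume_cube_diff_openCube` — the boundary of the cube is null;
* `soloInformed_presentable_of_nashImage` — the Nash-image lemma.

References: Kontsevich–Zagier 2001 §1.2 (rules (1), (2)); Ayoub 2014 §2.2 Def. 9; BCR 1998 §2.2,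
§8.1 (Nash functions); Shiota 1984 (Publ. RIMS 20) Prop. 6.18 (Nash triangulations).
-/

noncomputable section

open scoped BigOperators
open MeasureTheory Set
open Literature.NumberTheory.Transcendental Literature.NumberTheory.Transcendental.KZ
open Literature.ModelTheory.ExponentialFields (IsSemialgebraic isSemialgebraic_setOf_eval_lt)

namespace Summit.KontsevichZagierPeriods.KontsevichZagierPeriods.Theorems

/-! ### LEMMA Q for cube germs and the germ representation -/

/-- Gluing over `ℚ`: a function semialgebraic on each of finitely many pieces is semialgebraic on
their union. [BCR 1998, §2.2] -/
theorem soloInformed_isSemialgebraicFunOn_iUnion {m : ℕ} {ι : Type*} [Fintype ι]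
    (S : ι → Set (Fin m → ℝ)) {f : (Fin m → ℝ) → ℝ} (hf : ∀ i, IsSemialgebraicFunOn ℚ (S i) f) :
    IsSemialgebraicFunOn ℚ (⋃ i, S i) f := by
  unfold IsSemialgebraicFunOn at hf ⊢
  have hset : {z : Fin (m + 1) → ℝ | ∃ x ∈ ⋃ i, S i, z = Fin.snoc x (f x)} =
      ⋃ i ∈ (Finset.univ : Finset ι), {z : Fin (m + 1) → ℝ | ∃ x ∈ S i, z = Fin.snoc x (f x)} := by
    ext z
    simp only [mem_setOf_eq, mem_iUnion, Finset.mem_univ, exists_true_left]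
    constructor
    · rintro ⟨x, ⟨i, hx⟩, rfl⟩
      exact ⟨i, x, hx, rfl⟩
    · rintro ⟨i, x, hx, rfl⟩
      exact ⟨x, ⟨i, hx⟩, rfl⟩
  rw [hset]
  exact Literature.ModelTheory.ExponentialFields.IsSemialgebraic.biUnion _ _ fun i _ => hf i

/-- **LEMMA Q for cube germs**: the real part of a cube germ is `ℚ`-semialgebraic on the cube.
Proof: on each cell of a fine rational grid the rescaled germ is an Ayoub generator of radius `2`
(`soloInformedGridGen`), to which LEMMA Q (`soloInformed_ayoubLemmaQ`) applies; transport back by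
the affine grid map and glue. [BCR 1998, §8.1; Ayoub 2014, Def. 9] -/
theorem soloInformed_cubeGerm_isSemialgebraicFunOn {n : ℕ} (G : SoloInformedCubeGerm n) :
    IsSemialgebraicFunOn ℚ (soloInformedCube n) (fun x => (G.g (soloInformedToC n x)).re) := by
  obtain ⟨P, hP, hPg⟩ := G.algebraic
  obtain ⟨N, hN, hj⟩ := soloInformed_exists_grid_mapsTo G.isOpen G.mapsTo
  have hNr : (N : ℝ) ≠ 0 := by exact_mod_cast hN.ne'
  -- on each grid cell
  have hcell : ∀ j : Fin n → Fin N, IsSemialgebraicFunOn ℚ (soloInformedGridCell N j)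
      (fun x => (G.g (soloInformedToC n x)).re) := by
    intro j
    obtain ⟨W, -, hW, -, hWs⟩ :=
      soloInformed_ayoubLemmaQ n (soloInformedGridGen G.analytic G.real hP hPg hN j (hj j))
    -- the rescaled function on the cube
    have h1 : IsSemialgebraicFunOn ℚ (soloInformedCube n)
        (fun x => (G.g (soloInformedToC n (soloInformedGridMap N j x))).re) := by
      have h0 := (hWs.mono hW (isSemialgebraic_soloInformedCube n)).congr
        (fun x _ => soloInformedGridGen_re G.analytic G.real hP hPg hN j (hj j) x)
      have := soloInformed_isSemialgebraicFunOn_const_mul h0 (c := (N : ℚ) ^ n)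
        (pow_ne_zero _ (by exact_mod_cast hN.ne'))
      refine this.congr fun x _ => ?_
      simp only [Rat.cast_pow, Rat.cast_natCast]
      rw [← mul_assoc, mul_inv_cancel₀ (pow_ne_zero _ hNr), one_mul]
    -- transport by the inverse affine map `y ↦ N y − j`, a polynomial map over `ℚ`
    have hinv : IsSemialgebraicMapOn ℚ (soloInformedGridCell N j)
        (fun y l => (N : ℝ) * y l - ((j l : ℕ) : ℝ)) := by
      refine (isSemialgebraicMapOn_aeval (R := ℝ) (isSemialgebraic_soloInformedGridCell N j)
        fun l : Fin n => MvPolynomial.C (N : ℚ) * MvPolynomial.X l -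
          MvPolynomial.C ((j l : ℕ) : ℚ)).congr fun x _ => ?_
      ext l
      simp only [map_sub, map_mul, MvPolynomial.aeval_C, MvPolynomial.aeval_X, eq_ratCast]
      push_cast
      ring
    have hmaps : MapsTo (fun y l => (N : ℝ) * y l - ((j l : ℕ) : ℝ)) (soloInformedGridCell N j)
        (soloInformedCube n) := by
      intro y hy
      rw [← soloInformed_image_gridMap_cube hN j] at hy
      obtain ⟨x, hx, rfl⟩ := hy
      convert hx using 1
      ext l
      simp only [soloInformedGridMap_apply]
      field_simp
      ring
    have hcomp := IsSemialgebraicFunOn.comp_isSemialgebraicMapOn_holds h1 hinv hmaps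
    refine hcomp.congr fun y hy => ?_
    simp only [Function.comp]
    congr 3
    ext l
    simp only [soloInformedGridMap_apply]
    field_simp
    ring
  rw [← soloInformed_iUnion_gridCell hN]
  exact soloInformed_isSemialgebraicFunOn_iUnion _ hcell

/-- The real part of a cube germ is continuous on the cube. -/
theorem soloInformed_cubeGerm_continuousOn {n : ℕ} (G : SoloInformedCubeGerm n) :
    ContinuousOn (fun x => (G.g (soloInformedToC n x)).re) (soloInformedCube n) :=
  Complex.continuous_re.comp_continuousOn
    ((G.analytic.continuousOn.comp (soloInformedToC n).continuous.continuousOn G.mapsTo))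

/-- The cube representation `[[0,1]ⁿ, Re G ∘ ι]` of a cube germ. [Ayoub 2014, §2.2, Def. 9] -/
def soloInformedGermRep {n : ℕ} (G : SoloInformedCubeGerm n) : IntegralRep n :=
  soloInformedCubeRep n (fun x => (G.g (soloInformedToC n x)).re)
    (soloInformed_cubeGerm_isSemialgebraicFunOn G) (soloInformed_cubeGerm_continuousOn G)

/-- Domain of the germ representation. -/
@[simp] theorem soloInformedGermRep_domain {n : ℕ} (G : SoloInformedCubeGerm n) :
    (soloInformedGermRep G).domain = soloInformedCube n := rfl

/-- Integrand of the germ representation. -/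
@[simp] theorem soloInformedGermRep_integrand {n : ℕ} (G : SoloInformedCubeGerm n) :
    (soloInformedGermRep G).integrand = fun x => (G.g (soloInformedToC n x)).re := rfl

/-- A cube representation whose integrand is the real part of a cube germ is presentable
(one term, multiple `1`). -/
theorem soloInformed_presentable_of_germ {n : ℕ} (G : SoloInformedCubeGerm n) (ρ : IntegralRep n)
    (hd : ρ.domain = soloInformedCube n)
    (hI : EqOn ρ.integrand (fun x => (G.g (soloInformedToC n x)).re) (soloInformedCube n)) :
    of ρ ∈ soloInformedPresentable :=
  soloInformed_mem_presentable_iff.2 ⟨1, one_ne_zero, Fin 1, inferInstance, fun _ => n,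
    fun _ => G, fun _ => 1, fun _ => ρ, fun _ => hd, fun _ => hI, by simp⟩

/-- The germ representation is presentable. -/
theorem soloInformed_presentable_germRep {n : ℕ} (G : SoloInformedCubeGerm n) :
    of (soloInformedGermRep G) ∈ soloInformedPresentable :=
  soloInformed_presentable_of_germ G _ rfl fun _ _ => rfl

/-! ### The open cube -/

/-- The open unit cube `(0,1)ᵐ`. -/
def soloInformedOpenCube (m : ℕ) : Set (Fin m → ℝ) := {z | ∀ j, 0 < z j ∧ z j < 1}

/-- Membership in the open cube. -/
theorem soloInformed_mem_openCube_iff {m : ℕ} {z : Fin m → ℝ} :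
    z ∈ soloInformedOpenCube m ↔ ∀ j, 0 < z j ∧ z j < 1 := Iff.rfl

/-- The open cube is the product of open intervals. -/
theorem soloInformedOpenCube_eq_pi (m : ℕ) :
    soloInformedOpenCube m = Set.pi univ fun _ => Ioo (0 : ℝ) 1 := by
  ext z; simp [soloInformedOpenCube, mem_Ioo]

/-- The open cube lies in the closed cube. -/
theorem soloInformedOpenCube_subset_cube (m : ℕ) : soloInformedOpenCube m ⊆ soloInformedCube m :=
  fun _ hz => soloInformed_mem_cube_iff.2 fun j => ⟨(hz j).1.le, (hz j).2.le⟩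

/-- The open cube is `ℚ`-semialgebraic. [BCR 1998, §2.1] -/
theorem isSemialgebraic_soloInformedOpenCube (m : ℕ) :
    IsSemialgebraic ℚ (soloInformedOpenCube m) := by
  have h1 : IsSemialgebraic ℚ (⋂ i ∈ (Finset.univ : Finset (Fin m)), {t : Fin m → ℝ | 0 < t i}) :=
    IsSemialgebraic.biInter Finset.univ _ fun i _ => by
      simpa using isSemialgebraic_setOf_eval_lt (k := ℚ) (R := ℝ) (0 : MvPolynomial (Fin m) ℚ)
        (MvPolynomial.X i)
  have h2 : IsSemialgebraic ℚ (⋂ i ∈ (Finset.univ : Finset (Fin m)), {t : Fin m → ℝ | t i < 1}) :=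
    IsSemialgebraic.biInter Finset.univ _ fun i _ => by
      simpa using isSemialgebraic_setOf_eval_lt (k := ℚ) (R := ℝ)
        (MvPolynomial.X i : MvPolynomial (Fin m) ℚ) 1
  have hset : soloInformedOpenCube m =
      (⋂ i ∈ (Finset.univ : Finset (Fin m)), {t : Fin m → ℝ | 0 < t i}) ∩
        ⋂ i ∈ (Finset.univ : Finset (Fin m)), {t : Fin m → ℝ | t i < 1} := by
    ext t
    simp [soloInformedOpenCube, forall_and]
  rw [hset]
  exact h1.inter h2

/-- **The boundary of the cube is null**: `vol([0,1]ᵐ \ (0,1)ᵐ) = 0`. -/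
theorem soloInformed_volume_cube_diff_openCube (m : ℕ) :
    volume (soloInformedCube m \ soloInformedOpenCube m) = 0 := by
  have h : (Set.pi univ fun _ : Fin m => Ioo (0 : ℝ) 1) =ᵐ[volume] Icc (0 : Fin m → ℝ) 1 :=
    Measure.univ_pi_Ioo_ae_eq_Icc
  rw [soloInformedCube_eq_Icc, soloInformedOpenCube_eq_pi]
  exact (ae_eq_set.1 h).2

/-! ### The Nash-image lemma -/

/-- **Nash images of the open cube are presentable.** Let `Φ` be `ℚ`-semialgebraic, injective
and differentiable (within) on the open cube `(0,1)ᵐ` with derivative `Φ'`, let `r` be an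
integral representation with domain `Φ((0,1)ᵐ)`, and suppose the pulled-back integrand
`r.integrand (Φ x) · |det Φ' x|` agrees on `(0,1)ᵐ` with the real part of a cube germ `G`. Then
`[r]` is presentable: `[r] ≡ [(0,1)ᵐ, Re G] ≡ [[0,1]ᵐ, Re G]` by rule (2) and a null boundary.
The Jacobian may degenerate on the boundary of the cube (polar-type collapses, power
substitutions); only analytic continuation of the pull-back across the boundary is used.
[Kontsevich–Zagier 2001, §1.2; Ayoub 2014, §2.2] -/
theorem soloInformed_presentable_of_nashImage {m : ℕ} (r : IntegralRep m)
    (Φ : (Fin m → ℝ) → (Fin m → ℝ)) (Φ' : (Fin m → ℝ) → ((Fin m → ℝ) →L[ℝ] (Fin m → ℝ)))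
    (G : SoloInformedCubeGerm m)
    (hΦs : IsSemialgebraicMapOn ℚ (soloInformedOpenCube m) Φ)
    (hΦd : ∀ x ∈ soloInformedOpenCube m, HasFDerivWithinAt Φ (Φ' x) (soloInformedOpenCube m) x)
    (hΦi : InjOn Φ (soloInformedOpenCube m))
    (hdom : r.domain = Φ '' soloInformedOpenCube m)
    (hint : ∀ x ∈ soloInformedOpenCube m,
      (G.g (soloInformedToC m x)).re = r.integrand (Φ x) * |(Φ' x).det|) :
    of r ∈ soloInformedPresentable := by
  set ρ := soloInformedGermRep G with hρ
  set ρ₀ : IntegralRep m := ρ.restrict (soloInformedOpenCube m)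
    (isSemialgebraic_soloInformedOpenCube m) (soloInformedOpenCube_subset_cube m) with hρ₀
  -- rule (2): `[ρ₀] − [r]`
  have h2 : of ρ₀ - of r ∈ relations := by
    refine changeOfVariablesRel_subset_relations ⟨m, ρ₀, r, Φ, Φ', ?_, ?_, ?_, ?_, ?_, rfl⟩
    · simpa [hρ₀] using hΦs
    · simpa [hρ₀] using hΦd
    · simpa [hρ₀] using hΦi
    · simpa [hρ₀] using hdom
    · intro x hx
      simp only [hρ₀, IntegralRep.domain_restrict] at hx
      exact hint x hx
  -- null boundary: `[ρ] − [ρ₀]`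
  have h1 : of ρ - of ρ₀ ∈ relations := by
    refine of_sub_of_mem_relations_of_null ρ ρ₀ ?_ ?_ fun _ _ => rfl
    · simpa [hρ₀, hρ] using soloInformed_volume_cube_diff_openCube m
    · simp [hρ₀, hρ, Set.sdiff_eq_empty.2 (soloInformedOpenCube_subset_cube m)]
  have h : of r - of ρ ∈ relations := by
    have := relations.add_mem h1 h2
    rw [show of ρ - of ρ₀ + (of ρ₀ - of r) = -(of r - of ρ) by abel] at this
    simpa using relations.neg_mem this
  exact soloInformed_presentable_of_sub_mem h (soloInformed_presentable_germRep G)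

end Summit.KontsevichZagierPeriods.KontsevichZagierPeriods.Theorems
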